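import Mathlib
import Summits.ValiantsHypothesis.ValiantsHypothesis.Theses.ValuativeGCT
import Literature.NumberTheory.DiophantineGeometry.SchurWeylPlethysmKroneckerBoundProofs

/-!
# `ValuativeGCT.ValuativeFlip` (stmt-ValiantsHypothesis-12624), line skew-restriction-rank —
# H2 `stub_truncT0_le_kronecker`: the untruncated census space is bounded by the rectangular
# Kronecker coefficient

## What

`stub_truncT0_le_kronecker`: for `m ≥ 1`, `λ ⊢ m δ` with at most `m²` parts and
`χ = λ* = (Weight.dualOfPartition (m*m) λ).toMatIdx`, the UNTRUNCATED census space
`T₀(λ) ⊂ ℂ[End(ℂ^{m×m})]` of the route — forms `G` in the matrix variables `X (j, i)`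
(`j, i : MatIdx m`) that are homogeneous of degree `m δ`, invariant under `G ↦ (A ↦ G(A M))` for
every matrix `M` in the `End`-stabiliser of `det_m` (`linSubst M det_m = det_m`; the substitution
`X (j,i) ↦ ∑_l M l i • X (j,l)`), and `B`-semi-invariant of weight `χ` under `G ↦ (A ↦ G(g⁻¹ A))`
for the upper-triangular Borel `B ⊂ GL(MatIdx m)` (the substitution
`X (j,i) ↦ ∑_l (g⁻¹) j l • X (l,i)`) — has dimension at most the rectangular Kronecker coefficient
`g(λ, m × δ, m × δ) = kroneckerCoeff ℂ λ □ □`, `□ = Nat.Partition.rectangle m δ`.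
This is the valuative truncation `T_U(λ)` of `Theses.ValuativeGCT.ValuativeFlip` with its valuative
factor dropped (`U = 0`), i.e. BLMW's "symmetric Kronecker coefficient ≤ Kronecker coefficient";
it is the step that makes `GCTMult.GctKroneckerFlip → ValuativeFlip` a theorem.

## Why / mechanism

P. Bürgisser, J. M. Landsberg, L. Manivel, J. Weyman, SIAM J. Comput. 40 (2011) §5.2,
Prop. 5.2.1 (= arXiv:0907.2850, Prop. 5.1): `ℂ[GL(W)·det_n] = ℂ[GL(W)]^{GL(W)(det_n)}` and
`mult_π ℂ[GL(W)·det_n]_δ = dim (S_π W)^{GL(W)(det_n)} ≤ k_{δ^n, δ^n, π}`, the last inequality by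
cutting the stabiliser down to (the Borel subgroups of) `SL(E) × SL(F) ⊂ GL(W)(det_n)`,
`W = E ⊗ F`. The tree already runs this argument for the highest-weight vectors of the orbit
closure `ℂ[Δ(det_m)]` (`Literature/…/SchurWeylPlethysmKroneckerBoundProofs.lean`,
`finrank_highestWeightSpace_orbitCoordRep_le`, `orbitMultiplicity_det_le_kroneckerCoeff_holds`);
here its §1 (passage from the orbit closure to semi-invariant polynomials on the matrix space) is
replaced by three direct verifications on a member `G` of the census space:

1. `G` is homogeneous of degree `m δ` (first factor);
2. right invariance `G(A M) = G(A)` for every `M` in the `End`-stabiliser of `det_m` and EVERY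
   matrix `A` (third factor, evaluated: `eval_aeval_mulRight`);
3. left semi-invariance `G(b A) = χ(b)⁻¹ G(A)` for upper triangular `b` and every `A` (fourth
   factor at `g = b⁻¹`, evaluated: `eval_aeval_mulLeft`, `weightChar_inv`).

Then (`finrank_le_kroneckerCoeff_of_forall`, any field of characteristic zero) the transport
`transportPoly (matIdxEquiv m)` to the alphabet `Fin (m*m)` is injective on the space and lands in
`pairPoly (boundSpace λ* X)`, `X = kronInvariants` (`exists_mem_boundSpace`, Fulton–Harris
Lemma 6.23: a homogeneous polynomial of degree `D` on `Mat_N` is `pairPoly` of a unique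
`𝔖_D`-invariant coefficient matrix; the stabilising family is `a ⊗ b`, `a, b` upper triangular
unimodular, `linSubstRep_reindexGL_kronFin_detFormLex`), and the tail of
`orbitMultiplicity_det_le_kroneckerCoeff_holds` is copied verbatim:
`D! · dim boundSpace = ∑_τ χ^λ(τ) χ^□(τ)² = D! · g(λ, □, □)` (`card_mul_finrank_boundSpace`,
`character_transposedPermRep_dualOfPartition`, `character_kronInvariantsPermRep`,
`kroneckerCoeff_eq_sum_spechtCharacter_holds`).

## Sources

* P. Bürgisser, J. M. Landsberg, L. Manivel, J. Weyman, *An overview of mathematical issues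
  arising in the geometric complexity theory approach to VP ≠ VNP*, SIAM J. Comput. 40(4) (2011)
  1179–1209, §5.2 Prop. 5.2.1; arXiv:0907.2850 §5.2 Prop. 5.1. [BLMW 2011 §5.2]
* W. Fulton, J. Harris, *Representation Theory. A First Course*, GTM 129 (1991), Lemma 6.23
  (with (2.9), Prop. 2.1, Ex. 4.51). [Fulton–Harris GTM 129, Lemma 6.23]
-/

namespace Summit.ValiantsHypothesis.ValiantsHypothesis.Theorems.ValuativeFlip

open Literature.NumberTheory.DiophantineGeometry Literature.Computability.AlgebraicComplexity
open MvPolynomial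
open scoped BigOperators Matrix Kronecker

-- `Summit.ValiantsHypothesis.ValiantsHypothesis.…` is the tree's mandated single-conjunct layout (Sub = Summit).
set_option linter.dupNamespace false

noncomputable section

/-! ## §1 Evaluating the two substitutions -/

section Subst

variable {σ k : Type*} [Fintype σ] [Field k]

/-- Evaluating an `aeval`-substitution by polynomials is evaluating at the evaluated substitution
(`MvPolynomial.eval₂Hom_bind₁`). [folklore] -/
theorem eval_aeval_eq_eval_eval {ι τ : Type*} (φ : τ → MvPolynomial ι k) (x : ι → k)
    (G : MvPolynomial τ k) : eval x (aeval φ G) = eval (fun t => eval x (φ t)) G :=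
  eval₂Hom_bind₁ (RingHom.id k) x φ G

/-- **`G ↦ G(A M)`**: the right substitution `X (j,i) ↦ ∑_l M l i • X (j,l)` of the census space,
evaluated at the matrix `A`, is evaluation at `A * M`. BLMW 2011 §5.2 (right translation on
`ℂ[End W]`). [folklore] -/
theorem eval_aeval_mulRight (M A : Matrix σ σ k) (G : MvPolynomial (σ × σ) k) :
    eval (fun p : σ × σ => A p.1 p.2)
        (aeval (fun p : σ × σ => ∑ l : σ, M l p.2 • (X (p.1, l) : MvPolynomial (σ × σ) k)) G) =
      eval (fun p : σ × σ => (A * M) p.1 p.2) G := by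
  rw [eval_aeval_eq_eval_eval]
  refine congrArg (fun f : σ × σ → k => eval f G) (funext fun p => ?_)
  simp only [map_sum, smul_eval, eval_X, Matrix.mul_apply]
  exact Finset.sum_congr rfl fun l _ => mul_comm _ _

/-- **`G ↦ G(N A)`**: the left substitution `X (j,i) ↦ ∑_l N j l • X (l,i)` of the census space
(`N = g⁻¹`), evaluated at the matrix `A`, is evaluation at `N * A`. BLMW 2011 §5.2 (left
translation on `ℂ[End W]`). [folklore] -/
theorem eval_aeval_mulLeft (N A : Matrix σ σ k) (G : MvPolynomial (σ × σ) k) :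
    eval (fun p : σ × σ => A p.1 p.2)
        (aeval (fun p : σ × σ => ∑ l : σ, N p.1 l • (X (l, p.2) : MvPolynomial (σ × σ) k)) G) =
      eval (fun p : σ × σ => (N * A) p.1 p.2) G := by
  rw [eval_aeval_eq_eval_eval]
  refine congrArg (fun f : σ × σ → k => eval f G) (funext fun p => ?_)
  simp only [map_sum, smul_eval, eval_X, Matrix.mul_apply]

end Subst

/-! ## §2 The bound for any space of homogeneous bi-(semi-)invariant forms -/

/-- **Symmetric Kronecker ≤ Kronecker** (BLMW 2011 Prop. 5.2.1, abstract form, any field of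
characteristic zero): a subspace `T ⊂ k[Mat_{MatIdx m}]` all of whose members `G` are homogeneous
of degree `m δ`, right invariant (`G(A M) = G(A)` for every `M` in the `End`-stabiliser of `det_m`
and every matrix `A`) and left `B`-semi-invariant of weight `λ*` (`G(b A) = λ*(b)⁻¹ G(A)` for
upper triangular `b`) has dimension at most `g(λ, m × δ, m × δ)`. Proof: the transport
`transportPoly (matIdxEquiv m)` embeds `T` into `pairPoly (boundSpace λ* kronInvariants)`
(`exists_mem_boundSpace` with the stabilising family `a ⊗ b`, `a, b` upper triangular unimodular,
`linSubstRep_reindexGL_kronFin_detFormLex`), and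
`dim boundSpace = g(λ, □, □)` (`card_mul_finrank_boundSpace`,
`character_transposedPermRep_dualOfPartition`, `character_kronInvariantsPermRep`,
`kroneckerCoeff_eq_sum_spechtCharacter_holds`), verbatim as in
`orbitMultiplicity_det_le_kroneckerCoeff_holds`. [BLMW 2011 §5.2 Prop. 5.2.1] -/
theorem finrank_le_kroneckerCoeff_of_forall (k : Type*) [Field k] [CharZero k] (m δ : ℕ)
    (lam : Nat.Partition (m * δ)) (hlam : lam.parts.card ≤ m * m)
    (T : Submodule k (MvPolynomial (MatIdx m × MatIdx m) k))
    (hT : ∀ G ∈ T, G.IsHomogeneous (m * δ) ∧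
      (∀ M : Matrix (MatIdx m) (MatIdx m) k,
        linSubst (MatIdx m) k M (detFormLex k m) = detFormLex k m →
          ∀ A : Matrix (MatIdx m) (MatIdx m) k,
            eval (fun p : MatIdx m × MatIdx m => (A * M) p.1 p.2) G =
              eval (fun p : MatIdx m × MatIdx m => A p.1 p.2) G) ∧
      (∀ b : GL (MatIdx m) k, IsUpperTriangular b → ∀ A : Matrix (MatIdx m) (MatIdx m) k,
        eval (fun p : MatIdx m × MatIdx m => ((b : Matrix (MatIdx m) (MatIdx m) k) * A) p.1 p.2) G =
          (weightChar ((Weight.dualOfPartition (m * m) lam).toMatIdx : Weight (MatIdx m)) b)⁻¹ *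
            eval (fun p : MatIdx m × MatIdx m => A p.1 p.2) G)) :
    Module.finrank k T ≤
      kroneckerCoeff k lam (Nat.Partition.rectangle m δ) (Nat.Partition.rectangle m δ) := by
  set χ₀ : Weight (Fin (m * m)) := Weight.dualOfPartition (m * m) lam with hχ₀
  set X : Submodule k (Word (m * m) (m * δ) → k) := kronInvariants k m (m * δ)
  have hX : ∀ τ : Equiv.Perm (Fin (m * δ)), X ≤ X.comap (wordPermRep k (m * m) (m * δ) τ) :=
    fun τ _ hx => wordPerm_mem_kronInvariants k m τ hx
  -- §1–§3 of the model: `dim T ≤ dim boundSpace`, through the injection `transportPoly ∘ subtype`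
  have hle : Module.finrank k T ≤ Module.finrank k (boundSpace k χ₀ X) := by
    set Γ : T →ₗ[k] MvPolynomial (Fin (m * m) × Fin (m * m)) k :=
      (transportPoly (k := k) (matIdxEquiv m)).toLinearMap ∘ₗ T.subtype with hΓ
    have hΓinj : Function.Injective Γ :=
      (transportPoly_injective (matIdxEquiv m)).comp Subtype.val_injective
    have hrange : LinearMap.range Γ ≤ (boundSpace k χ₀ X).map (pairPoly k (Fin (m * m)) (m * δ)) := by
      rintro _ ⟨G, rfl⟩
      obtain ⟨hhom, hright, hleft⟩ := hT (G : MvPolynomial (MatIdx m × MatIdx m) k) G.2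
      have hleft' := eval_transportPoly_mul_left (matIdxEquiv m)
        (G : MvPolynomial (MatIdx m × MatIdx m) k) (χ₀.toMatIdx : Weight (MatIdx m))
        (fun b hb g => hleft b hb (g : Matrix (MatIdx m) (MatIdx m) k))
      rw [toMatIdx_comp_matIdxEquiv] at hleft'
      obtain ⟨L, hL, hLP⟩ := exists_mem_boundSpace k (χ := χ₀) (X := X)
        (transportPoly (matIdxEquiv m) (G : MvPolynomial (MatIdx m × MatIdx m) k))
        (isHomogeneous_transportPoly (matIdxEquiv m) hhom) hleft'
        (IsKronUnimodularBorel k m) (mem_kronInvariants_of_forall k m)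
        (fun h hh => eval_transportPoly_mul_right (matIdxEquiv m) _ h fun g => by
          obtain ⟨a, b, -, ha1, -, hb1, rfl⟩ := hh
          refine hright _ ?_ _
          rw [← linSubstRep_apply]
          exact linSubstRep_reindexGL_kronFin_detFormLex k m ha1 hb1)
      have hΓG : Γ G = transportPoly (matIdxEquiv m) (G : MvPolynomial (MatIdx m × MatIdx m) k) := by
        rw [hΓ]
        rfl
      exact ⟨L, hL, hLP.trans hΓG.symm⟩
    calc Module.finrank k T
        = Module.finrank k (LinearMap.range Γ) := (LinearMap.finrank_range_of_inj hΓinj).symm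
      _ ≤ Module.finrank k ((boundSpace k χ₀ X).map (pairPoly k (Fin (m * m)) (m * δ))) :=
          Submodule.finrank_mono hrange
      _ ≤ Module.finrank k (boundSpace k χ₀ X) := Submodule.finrank_map_le _ _
  -- §3–§4 of the model, verbatim: `D! · dim boundSpace = ∑ χ^λ (χ^□)² = D! · g(λ, □, □)`
  have hcount := card_mul_finrank_boundSpace k χ₀ X hX
  rw [Fintype.card_perm, Fintype.card_fin, hχ₀,
    character_transposedPermRep_dualOfPartition k lam hlam] at hcount
  have hchar : ((wordPermRep k (m * m) (m * δ)).subrepresentation X hX).character =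
      spechtCharacter k (Nat.Partition.rectangle m δ) *
        spechtCharacter k (Nat.Partition.rectangle m δ) :=
    character_kronInvariantsPermRep k δ
  rw [hchar] at hcount
  have hkron := kroneckerCoeff_eq_sum_spechtCharacter_holds k lam (Nat.Partition.rectangle m δ)
    (Nat.Partition.rectangle m δ)
  have heq : ((Module.finrank k (boundSpace k χ₀ X) : ℕ) : k) =
      (kroneckerCoeff k lam (Nat.Partition.rectangle m δ) (Nat.Partition.rectangle m δ) : k) := by
    have hfact : (((m * δ).factorial : ℕ) : k) ≠ 0 :=
      Nat.cast_ne_zero.mpr (Nat.factorial_ne_zero _)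
    apply mul_left_cancel₀ hfact
    rw [hcount, ← Nat.cast_mul, hkron]
    refine Finset.sum_congr rfl fun τ _ => ?_
    rw [Pi.mul_apply]
    ring
  have heq' := Nat.cast_injective (R := k) heq
  calc Module.finrank k T
      ≤ Module.finrank k (boundSpace k χ₀ X) := hle
    _ = kroneckerCoeff k lam (Nat.Partition.rectangle m δ) (Nat.Partition.rectangle m δ) := heq'

/-! ## §3 The registered stub -/

/-- **H2** (registered stub of line skew-restriction-rank): for `λ ⊢ mδ` with at most `m²` parts, the space of
`G ∈ ℂ[End(ℂ^{m×m})]` homogeneous of degree `mδ`, invariant under `A ↦ A·M` for every `M` in the `End`-stabiliser of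
`det_m` and `B`-semi-invariant of weight `λ*` under `A ↦ g⁻¹A` (the crux's truncation without its valuative factor)
has dimension at most `g(λ, m×δ, m×δ)`: the three clauses are read off the membership
(`eval_aeval_mulRight`; `eval_aeval_mulLeft` at `g = b⁻¹` with `weightChar_inv`) and fed to
`finrank_le_kroneckerCoeff_of_forall`. [BLMW 2011 §5.2 Prop. 5.2.1] -/
theorem stub_truncT0_le_kronecker (m δ : ℕ) [NeZero m] (lam : Nat.Partition (m * δ))
    (hlam : lam.parts.card ≤ m * m) :
    Module.finrank ℂ ↥(MvPolynomial.homogeneousSubmodule (MatIdx m × MatIdx m) ℂ (m * δ) ⊓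
        (⨅ (M : Matrix (MatIdx m) (MatIdx m) ℂ)
          (_ : linSubst (MatIdx m) ℂ M (detFormLex ℂ m) = detFormLex ℂ m),
          LinearMap.ker ((MvPolynomial.aeval fun p : MatIdx m × MatIdx m =>
              ∑ l : MatIdx m, M l p.2 •
                (MvPolynomial.X (p.1, l) : MvPolynomial (MatIdx m × MatIdx m) ℂ)).toLinearMap -
            (LinearMap.id : MvPolynomial (MatIdx m × MatIdx m) ℂ →ₗ[ℂ] MvPolynomial (MatIdx m × MatIdx m) ℂ))) ⊓
        (⨅ (g : Matrix.GeneralLinearGroup (MatIdx m) ℂ) (_ : IsUpperTriangular g),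
          LinearMap.ker ((MvPolynomial.aeval fun p : MatIdx m × MatIdx m =>
              ∑ l : MatIdx m, ((g⁻¹ : Matrix.GeneralLinearGroup (MatIdx m) ℂ) :
                Matrix (MatIdx m) (MatIdx m) ℂ) p.1 l •
                  (MvPolynomial.X (l, p.2) : MvPolynomial (MatIdx m × MatIdx m) ℂ)).toLinearMap -
            weightChar ((Weight.dualOfPartition (m * m) lam).toMatIdx : Weight (MatIdx m)) g •
              (LinearMap.id : MvPolynomial (MatIdx m × MatIdx m) ℂ →ₗ[ℂ] MvPolynomial (MatIdx m × MatIdx m) ℂ)))) ≤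
      kroneckerCoeff ℂ lam (Nat.Partition.rectangle m δ) (Nat.Partition.rectangle m δ) := by
  refine finrank_le_kroneckerCoeff_of_forall ℂ m δ lam hlam _ fun G hG => ?_
  simp only [Submodule.mem_inf, Submodule.mem_iInf, LinearMap.mem_ker, LinearMap.sub_apply,
    LinearMap.smul_apply, LinearMap.id_apply, AlgHom.toLinearMap_apply, sub_eq_zero] at hG
  obtain ⟨⟨hG1, hG3⟩, hG4⟩ := hG
  refine ⟨(mem_homogeneousSubmodule _ _).mp hG1, fun M hM A => ?_, fun b hb A => ?_⟩
  · calc eval (fun p : MatIdx m × MatIdx m => (A * M) p.1 p.2) G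
        = eval (fun p : MatIdx m × MatIdx m => A p.1 p.2)
            (aeval (fun p : MatIdx m × MatIdx m => ∑ l : MatIdx m,
              M l p.2 • (X (p.1, l) : MvPolynomial (MatIdx m × MatIdx m) ℂ)) G) :=
          (eval_aeval_mulRight M A G).symm
      _ = eval (fun p : MatIdx m × MatIdx m => A p.1 p.2) G := by rw [hG3 M hM]
  · have h := hG4 b⁻¹ ((borelSubgroup (MatIdx m) ℂ).inv_mem hb)
    rw [inv_inv, weightChar_inv _ hb] at h
    calc eval (fun p : MatIdx m × MatIdx m => ((b : Matrix (MatIdx m) (MatIdx m) ℂ) * A) p.1 p.2) G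
        = eval (fun p : MatIdx m × MatIdx m => A p.1 p.2)
            (aeval (fun p : MatIdx m × MatIdx m => ∑ l : MatIdx m,
              (b : Matrix (MatIdx m) (MatIdx m) ℂ) p.1 l •
                (X (l, p.2) : MvPolynomial (MatIdx m × MatIdx m) ℂ)) G) :=
          (eval_aeval_mulLeft (b : Matrix (MatIdx m) (MatIdx m) ℂ) A G).symm
      _ = (weightChar ((Weight.dualOfPartition (m * m) lam).toMatIdx : Weight (MatIdx m)) b)⁻¹ *
            eval (fun p : MatIdx m × MatIdx m => A p.1 p.2) G := by rw [h, smul_eval]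

end

end Summit.ValiantsHypothesis.ValiantsHypothesis.Theorems.ValuativeFlip
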